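import Summits.QuantumFields.YangMills.Theses.ThermodynamicCeilings

/-!
# Route `ThermodynamicCeilings` — BC5 / instrument rung for the crux `WindowedSpectralMeasure` (27776): the free `F²` weight

D-0145 ideator seat ym-idea-11 (g5, lens «wuc»); asked for by the critic (idea-crit-9, VERDICT #36 price F2: "type or kit-run the
free-lattice-Maxwell values rather than quote them").  TOY-MODEL RUNG, not a statement about Wilson measures: in free Maxwell theory
the connected plaquette–plaquette (`F²–F²`) correlator along an axis decays like `t⁻⁸ = ∫₀^∞ e^{-Et} E⁷/7! dE`, so the
transfer-matrix-channel spectral weight is `E⁷ dE`; with a sharp cutoff `M ≥ 1` (lattice units) we take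
`((volume.restrict (Ioc (0:ℝ) M)).withDensity fun E => ENNReal.ofReal (E ^ 7)) := (Lebesgue on (0, M]) with density E⁷`.  We PROVE, uniformly in the cutoff `M`, the two clauses of
`WindowedSpectralMeasure` that carry its content: the windowed degree-8 doubling (clause (ii)) holds with the SHARP constant `A = 1`
(indeed with equality `ν([0,λx)) = λ⁸ ν([0,x))`), and the Laplace-weighted UV bound (clause (iii))
`∫_{E ≥ 1} e^{-2E} dν ≤ A·ν([0,1))` holds with `A = 8·7⁷` for every `M ≥ 1`.  This is the instrument row / cheapest falsifier of
27776 in the one model where the spectral weight is explicit; it exercises exactly the route's lever (degree-8 homogeneity of the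
`F²` channel) and says nothing about Yang–Mills.  Mathlib only.  No summit / leaf / NT / UV / IR statement is proved.
-/

namespace Summit.QuantumFields.YangMills.Cruxes.ScaleMonotonicity.FreeRung

open MeasureTheory Set

/-! The free `F²`-channel spectral weight with sharp cutoff `M` is written out verbatim below as
`(volume.restrict (Ioc 0 M)).withDensity (E ↦ E⁷)` (Lebesgue measure on `(0, M]` with density `E⁷`); no new definition is introduced. -/

/-- The density `E ↦ E⁷` (as `ℝ≥0∞`) is measurable. -/
theorem measurable_density : Measurable fun E : ℝ => ENNReal.ofReal (E ^ 7) :=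
  ENNReal.measurable_ofReal.comp (measurable_id.pow_const 7)

/-- The free weight is a finite measure. -/
theorem isFiniteMeasure_freeF2 (M : ℝ) : IsFiniteMeasure ((volume.restrict (Ioc (0:ℝ) M)).withDensity fun E => ENNReal.ofReal (E ^ 7)) := by
  refine isFiniteMeasure_withDensity (ne_of_lt ?_)
  have hae : ∀ᵐ E ∂(volume.restrict (Ioc (0:ℝ) M)), ENNReal.ofReal (E ^ 7) ≤ ENNReal.ofReal (M ^ 7) := by
    filter_upwards [ae_restrict_mem measurableSet_Ioc] with E hE
    exact ENNReal.ofReal_le_ofReal (pow_le_pow_left₀ hE.1.le hE.2 7)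
  calc ∫⁻ E, ENNReal.ofReal (E ^ 7) ∂(volume.restrict (Ioc (0:ℝ) M))
      ≤ ∫⁻ _, ENNReal.ofReal (M ^ 7) ∂(volume.restrict (Ioc (0:ℝ) M)) := lintegral_mono_ae hae
    _ = ENNReal.ofReal (M ^ 7) * volume (Ioc (0:ℝ) M) := by rw [lintegral_const, Measure.restrict_apply_univ]
    _ < ⊤ := by
        rw [Real.volume_Ioc]
        exact ENNReal.mul_lt_top ENNReal.ofReal_lt_top ENNReal.ofReal_lt_top

/-- The free weight lives on `(0, ∞)`. -/
theorem freeF2_Iic_zero (M : ℝ) : ((volume.restrict (Ioc (0:ℝ) M)).withDensity fun E => ENNReal.ofReal (E ^ 7)) (Iic 0) = 0 := by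
  refine withDensity_absolutelyContinuous _ _ ?_
  rw [Measure.restrict_apply measurableSet_Iic]
  have : Iic (0:ℝ) ∩ Ioc 0 M = ∅ := by
    ext E; simp only [mem_inter_iff, mem_Iic, mem_Ioc, mem_empty_iff_false, iff_false]; intro h; linarith [h.1, h.2.1]
  rw [this, measure_empty]

/-- The cumulative function of the free weight: `ν((−∞, y)) = y⁸/8` for `0 ≤ y ≤ M`. -/
theorem freeF2_Iio (M y : ℝ) (hy : 0 ≤ y) (hyM : y ≤ M) : ((volume.restrict (Ioc (0:ℝ) M)).withDensity fun E => ENNReal.ofReal (E ^ 7)) (Iio y) = ENNReal.ofReal (y ^ 8 / 8) := by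
  rw [withDensity_apply _ measurableSet_Iio, Measure.restrict_restrict measurableSet_Iio]
  have hset : Iio y ∩ Ioc (0:ℝ) M = Ioo 0 y := by
    ext E; simp only [mem_inter_iff, mem_Iio, mem_Ioc, mem_Ioo]
    constructor
    · rintro ⟨h1, h2, _⟩; exact ⟨h2, h1⟩
    · rintro ⟨h1, h2⟩; exact ⟨h2, h1, by linarith⟩
  rw [hset]
  have hI : IntegrableOn (fun E : ℝ => E ^ 7) (Ioo 0 y) volume :=
    ((continuous_id.pow 7).integrableOn_Icc).mono_set Ioo_subset_Icc_self
  have hval : ∫ E in Ioo (0:ℝ) y, E ^ 7 = y ^ 8 / 8 := by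
    rw [← integral_Ioc_eq_integral_Ioo, ← intervalIntegral.integral_of_le hy, integral_pow]
    norm_num
  rw [← hval, ofReal_integral_eq_lintegral_ofReal hI]
  filter_upwards [ae_restrict_mem measurableSet_Ioo] with E hE
  exact pow_nonneg hE.1.le 7

/-- Clause (ii) of `WindowedSpectralMeasure` in the free model, with the SHARP constant: windowed degree-8 doubling with `A = 1`
(no threshold needed: it holds for every `x`, on the window `λx ≤ 1 ≤ M`). -/
theorem freeF2_window_doubling (M : ℝ) (hM : 1 ≤ M) :
    ∀ lam x : ℝ, 1 ≤ lam → lam * x ≤ 1 →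
      (((volume.restrict (Ioc (0:ℝ) M)).withDensity fun E => ENNReal.ofReal (E ^ 7)) (Iio (lam * x))).toReal ≤ 1 * lam ^ 8 * (((volume.restrict (Ioc (0:ℝ) M)).withDensity fun E => ENNReal.ofReal (E ^ 7)) (Iio x)).toReal := by
  intro lam x hl hlx
  rcases lt_or_ge x 0 with hx | hx
  · have hlx0 : lam * x ≤ 0 := by nlinarith
    have h0 : ((volume.restrict (Ioc (0:ℝ) M)).withDensity fun E => ENNReal.ofReal (E ^ 7)) (Iio (lam * x)) = 0 :=
      measure_mono_null (fun E (hE : E < lam * x) => show E ≤ 0 by linarith) (freeF2_Iic_zero M)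
    rw [h0, ENNReal.toReal_zero]
    have : 0 ≤ (((volume.restrict (Ioc (0:ℝ) M)).withDensity fun E => ENNReal.ofReal (E ^ 7)) (Iio x)).toReal := ENNReal.toReal_nonneg
    positivity
  · have hxl : x ≤ lam * x := by nlinarith
    rw [freeF2_Iio M (lam * x) (by nlinarith) (by linarith), freeF2_Iio M x hx (by linarith),
      ENNReal.toReal_ofReal (by positivity), ENNReal.toReal_ofReal (by positivity)]
    ring_nf
    rfl

/-- `E⁷ ≤ 7⁷ e^{E}` for `E ≥ 0`. -/
theorem pow_seven_le_exp (E : ℝ) (hE : 0 ≤ E) : E ^ 7 ≤ 7 ^ 7 * Real.exp E := by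
  have h1 : E / 7 ≤ Real.exp (E / 7) := by linarith [Real.add_one_le_exp (E / 7)]
  have h2 : E ≤ 7 * Real.exp (E / 7) := by linarith
  have h3 : E ^ 7 ≤ (7 * Real.exp (E / 7)) ^ 7 := pow_le_pow_left₀ hE h2 7
  have h4 : (7 * Real.exp (E / 7)) ^ 7 = 7 ^ 7 * Real.exp E := by
    rw [mul_pow, ← Real.exp_nat_mul]; congr 1; congr 1; push_cast; ring
  exact h3.trans_eq h4

/-- Clause (iii) of `WindowedSpectralMeasure` in the free model: `∫_{E ≥ 1} e^{-2E} dν ≤ 8·7⁷ · ν([0,1))`, uniformly in the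
cutoff `M ≥ 1` (the right-hand side is `8·7⁷ · (1/8) = 7⁷`). -/
theorem freeF2_uv (M : ℝ) (hM : 1 ≤ M) :
    (∫ E in Ici (1:ℝ), Real.exp (-(2 * E)) ∂((volume.restrict (Ioc (0:ℝ) M)).withDensity fun E => ENNReal.ofReal (E ^ 7))) ≤ 8 * 7 ^ 7 * (((volume.restrict (Ioc (0:ℝ) M)).withDensity fun E => ENNReal.ofReal (E ^ 7)) (Iio 1)).toReal := by
  have hcum : (((volume.restrict (Ioc (0:ℝ) M)).withDensity fun E => ENNReal.ofReal (E ^ 7)) (Iio 1)).toReal = 1 / 8 := by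
    rw [freeF2_Iio M 1 zero_le_one hM, ENNReal.toReal_ofReal (by norm_num)]; norm_num
  rw [hcum]
  -- rewrite the weighted integral as a Lebesgue integral over `Icc 1 M`
  have hset : Ici (1:ℝ) ∩ Ioc 0 M = Icc 1 M := by
    ext E; simp only [mem_inter_iff, mem_Ici, mem_Ioc, mem_Icc]
    constructor
    · rintro ⟨h1, _, h3⟩; exact ⟨h1, h3⟩
    · rintro ⟨h1, h2⟩; exact ⟨h1, by linarith, h2⟩
  have hrw : (∫ E in Ici (1:ℝ), Real.exp (-(2 * E)) ∂((volume.restrict (Ioc (0:ℝ) M)).withDensity fun E => ENNReal.ofReal (E ^ 7))) =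
      ∫ E in Icc (1:ℝ) M, E ^ 7 * Real.exp (-(2 * E)) := by
    rw [restrict_withDensity measurableSet_Ici,
      integral_withDensity_eq_integral_toReal_smul measurable_density
        (Filter.Eventually.of_forall fun _ => ENNReal.ofReal_lt_top),
      Measure.restrict_restrict measurableSet_Ici, hset]
    refine setIntegral_congr_fun measurableSet_Icc fun E hE => ?_
    rw [smul_eq_mul, ENNReal.toReal_ofReal (by have := hE.1; positivity)]
  rw [hrw]
  -- pointwise bound `E⁷ e^{-2E} ≤ 7⁷ e^{-E}` and the improper integral `∫_{E>0} e^{-E} dE = 1`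
  have hI1 : IntegrableOn (fun E : ℝ => E ^ 7 * Real.exp (-(2 * E))) (Icc 1 M) volume :=
    (by fun_prop : Continuous fun E : ℝ => E ^ 7 * Real.exp (-(2 * E))).integrableOn_Icc
  have hI2 : IntegrableOn (fun E : ℝ => 7 ^ 7 * Real.exp (-E)) (Icc 1 M) volume :=
    (by fun_prop : Continuous fun E : ℝ => 7 ^ 7 * Real.exp (-E)).integrableOn_Icc
  have hI3 : IntegrableOn (fun E : ℝ => 7 ^ 7 * Real.exp (-E)) (Ioi 0) volume := by
    have h := (exp_neg_integrableOn_Ioi 0 zero_lt_one).const_mul ((7:ℝ) ^ 7)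
    exact IntegrableOn.congr_fun h (fun E _ => by simp only [neg_mul, one_mul]) measurableSet_Ioi
  have hstep1 : (∫ E in Icc (1:ℝ) M, E ^ 7 * Real.exp (-(2 * E))) ≤ ∫ E in Icc (1:ℝ) M, 7 ^ 7 * Real.exp (-E) := by
    refine setIntegral_mono_on hI1 hI2 measurableSet_Icc fun E hE => ?_
    have hE0 : 0 ≤ E := by linarith [hE.1]
    have h7 := pow_seven_le_exp E hE0
    have hsplit : Real.exp (-(2 * E)) = Real.exp (-E) * Real.exp (-E) := by
      rw [← Real.exp_add]; ring_nf
    have hee : Real.exp E * Real.exp (-E) = 1 := by rw [← Real.exp_add, add_neg_cancel, Real.exp_zero]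
    have hpos : 0 < Real.exp (-E) := Real.exp_pos _
    calc E ^ 7 * Real.exp (-(2 * E)) = E ^ 7 * Real.exp (-E) * Real.exp (-E) := by rw [hsplit]; ring
      _ ≤ 7 ^ 7 * Real.exp E * Real.exp (-E) * Real.exp (-E) := by gcongr
      _ = 7 ^ 7 * Real.exp (-E) := by
          rw [show (7:ℝ) ^ 7 * Real.exp E * Real.exp (-E) = 7 ^ 7 * (Real.exp E * Real.exp (-E)) by ring, hee, mul_one]
  have hstep2 : (∫ E in Icc (1:ℝ) M, 7 ^ 7 * Real.exp (-E)) ≤ ∫ E in Ioi (0:ℝ), 7 ^ 7 * Real.exp (-E) := by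
    refine setIntegral_mono_set hI3 ?_ ?_
    · exact Filter.Eventually.of_forall fun E => by positivity
    · exact Filter.Eventually.of_forall fun E (hE : E ∈ Icc (1:ℝ) M) => show E ∈ Ioi (0:ℝ) by
        simp only [mem_Ioi]; linarith [hE.1]
  have hstep3 : (∫ E in Ioi (0:ℝ), 7 ^ 7 * Real.exp (-E)) = 7 ^ 7 := by
    rw [integral_const_mul, integral_exp_neg_Ioi_zero, mul_one]
  linarith

/-- **The rung, packaged in the clause shape of `WindowedSpectralMeasure`** (any threshold `E₀`, single constant `A = 8·7⁷`,
every cutoff `M ≥ 1`): finite measure on `(0,∞)`, windowed degree-8 doubling, Laplace-weighted UV bound. -/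
theorem windowedSpectralMeasure_rung_free (M : ℝ) (hM : 1 ≤ M) (E₀ : ℝ) :
    IsFiniteMeasure ((volume.restrict (Ioc (0:ℝ) M)).withDensity fun E => ENNReal.ofReal (E ^ 7)) ∧ ((volume.restrict (Ioc (0:ℝ) M)).withDensity fun E => ENNReal.ofReal (E ^ 7)) (Iic 0) = 0 ∧
    (∀ lam x : ℝ, 1 ≤ lam → E₀ ≤ x → lam * x ≤ 1 →
      (((volume.restrict (Ioc (0:ℝ) M)).withDensity fun E => ENNReal.ofReal (E ^ 7)) (Iio (lam * x))).toReal ≤ (8 * 7 ^ 7) * lam ^ 8 * (((volume.restrict (Ioc (0:ℝ) M)).withDensity fun E => ENNReal.ofReal (E ^ 7)) (Iio x)).toReal) ∧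
    ((∫ E in Ici (1:ℝ), Real.exp (-(2 * E)) ∂((volume.restrict (Ioc (0:ℝ) M)).withDensity fun E => ENNReal.ofReal (E ^ 7))) ≤ (8 * 7 ^ 7) * (((volume.restrict (Ioc (0:ℝ) M)).withDensity fun E => ENNReal.ofReal (E ^ 7)) (Iio 1)).toReal) := by
  refine ⟨isFiniteMeasure_freeF2 M, freeF2_Iic_zero M, fun lam x hl _ hlx => ?_, freeF2_uv M hM⟩
  have h := freeF2_window_doubling M hM lam x hl hlx
  have hnn : 0 ≤ lam ^ 8 * (((volume.restrict (Ioc (0:ℝ) M)).withDensity fun E => ENNReal.ofReal (E ^ 7)) (Iio x)).toReal := by positivity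
  nlinarith

end Summit.QuantumFields.YangMills.Cruxes.ScaleMonotonicity.FreeRung
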